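import Mathlib

/-!
# FockLadder — kernel witnesses for the «ladder» irreducibility of (N4.3.P2-bis) / (N4.3.P2-ter)

Cell pub-hodge-repro2, Tier 5, sub-step N4.3 (route/T5-N4-p5.md v3, owner p5); kernel support by
seat p4.  The prose proves the irreducibility of the Fock submodule `ℂ[Q]` (and of the weight-`c`
ladder `span{w₁^{a+k} w₂^{b+k}}`) DIRECTLY: raising = multiplication by `Q`, lowering
`D = Σ_i ∂²/∂w_{i,1}∂w_{i,2}`, `D(Q^k) = k(k+2) Q^{k-1} ≠ 0` for `k ≥ 1`, «so every non-zero
submodule contains `1 = Q⁰` and then every `Q^k`».  This file kernel-checks exactly that algebra: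

1. `IsLadder` (abstract): `v : ℕ → V` linearly independent, `R (v k) = r k • v (k+1)` (`r k ≠ 0`),
   `D (v k) = a k • v (k-1)` (`a 0 = 0`, `a k ≠ 0` for `k ≥ 1`).  `IsLadder.eq_span_of_stable`: a
   non-zero subspace of `span (range v)` stable under `R` and `D` is the whole span;
   `IsLadder.mem_span_singleton_of_lower_eq_zero`: `ker D` on the span is the line `K ∙ v 0`.
2. The `Q`-ladder of (N4.3.P2-bis): `Q = Σ_{i : Fin 3} X (i,0) * X (i,1)` in `K[w_{i,j}]` (`K` any
   field; `ℂ` in the prose), `lowering = Σ_i pderiv (i,0) ∘ pderiv (i,1)`, `raising = (Q * ·)`: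
   `lowering_Q_pow : lowering (Q ^ k) = (k * (k + 2)) • Q ^ (k - 1)` (the printed identity),
   `linearIndependent_Q_pow` (homogeneity of degree `2k`), `isLadder_Q` (`K` of characteristic
   zero), `QSpan_eq_of_stable` (every non-zero submodule of `ℂ[Q]` stable under `Q·` and `D` is
   `ℂ[Q]`), `QSpan_ker_lowering` (`ker D ∩ ℂ[Q] = ℂ·1`, the lowest `K_W`-type line).
3. The two-variable ladder of (N4.3.P2-ter): `mono a b k = X 0 ^ (a + k) * X 1 ^ (b + k)` with
   `a * b = 0` (`a = max(0,-c)`, `b = max(0,c)` for the weight `c`: `toNat_neg_mul_toNat`),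
   `lowering₂ = pderiv 0 ∘ pderiv 1`, `raising₂ = (X 0 * X 1) * ·`: `lowering₂_X_pow_mul_X_pow`
   (`∂²(w₁^α w₂^β) = αβ w₁^{α-1} w₂^{β-1}`), `lowering₂_mono`, `isLadder_mono`,
   `monoSpan_eq_of_stable`, `monoSpan_ker_lowering`.

NOT formalised (the prose's [C]/[A] inputs, G-N4.3.5 / [KK07] Prop. 4.4 / the first fundamental
theorem for U(3)): that these operators ARE the `𝔭^±`-operators of `𝔲(1,1)` on the Fock model up to
non-zero scalars, and that the `U(3)`-invariants of the Fock space are `ℂ[Q]`.  Everything here is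
about the polynomial ring and the two explicit operators only.
-/

namespace Summit.Ventures.HodgeRepro2.FockLadder

open MvPolynomial Finset Set

section Abstract
variable {K : Type*} [Field K] {V : Type*} [AddCommGroup V] [Module K V]

/-- A *ladder*: a linearly independent sequence `v` with a raising operator `R` sending `v k` to a
non-zero multiple of `v (k+1)` and a lowering operator `D` sending `v k` to `a k • v (k-1)`, where
`a 0 = 0` (the bottom vector is killed) and `a k ≠ 0` for `k ≥ 1`.  (`k - 1` is truncated
subtraction, so `D (v 0) = a 0 • v 0 = 0`.) -/
structure IsLadder (v : ℕ → V) (R D : V →ₗ[K] V) (r a : ℕ → K) : Prop where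
  linInd : LinearIndependent K v
  r_ne : ∀ k, r k ≠ 0
  a_zero : a 0 = 0
  a_ne : ∀ k, 0 < k → a k ≠ 0
  raise : ∀ k, R (v k) = r k • v (k + 1)
  lower : ∀ k, D (v k) = a k • v (k - 1)

namespace IsLadder
variable {v : ℕ → V} {R D : V →ₗ[K] V} {r a : ℕ → K} (h : IsLadder v R D r a)
include h

/-- The lowering operator on a finite combination `Σ_{i ≤ N} c i • v i`: the bottom term dies and
the others shift down by one. -/
theorem lower_sum (N : ℕ) (c : Fin (N + 1) → K) :
    D (∑ i, c i • v i) = ∑ i : Fin N, (c i.succ * a i.succ) • v i := by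
  rw [map_sum, Fin.sum_univ_succ]
  simp only [map_smul, h.lower, Fin.val_zero, zero_tsub, h.a_zero, zero_smul, smul_zero, zero_add,
    Fin.val_succ, Nat.add_sub_cancel, smul_smul]

/-- If `D` kills `Σ_{i ≤ N} c i • v i`, every coefficient above the bottom vanishes. -/
theorem coeff_succ_eq_zero_of_lower_eq_zero (N : ℕ) (c : Fin (N + 1) → K)
    (hc : D (∑ i, c i • v i) = 0) (i : Fin N) : c i.succ = 0 := by
  rw [h.lower_sum] at hc
  have hli : LinearIndependent K (fun i : Fin N => v i) :=
    h.linInd.comp (fun i : Fin N => (i : ℕ)) Fin.val_injective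
  have := (Fintype.linearIndependent_iff.mp hli) _ hc i
  exact (mul_eq_zero.mp this).resolve_right (h.a_ne _ (Nat.succ_pos _))

/-- If `D` kills `Σ_{i ≤ N} c i • v i`, that vector is `c 0 • v 0`. -/
theorem eq_smul_of_lower_eq_zero (N : ℕ) (c : Fin (N + 1) → K)
    (hc : D (∑ i, c i • v i) = 0) : ∑ i, c i • v i = c 0 • v 0 := by
  rw [Fin.sum_univ_succ]
  have : ∑ i : Fin N, c i.succ • v i.succ = 0 :=
    Finset.sum_eq_zero fun i _ => by
      rw [h.coeff_succ_eq_zero_of_lower_eq_zero N c hc i, zero_smul]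
  rw [this, add_zero]
  simp

omit h in
/-- Every element of `span (range v)` is a finite combination `Σ_{i ≤ N} c i • v i`. -/
theorem exists_fin_sum_of_mem_span {p : V} (hp : p ∈ Submodule.span K (range v)) :
    ∃ N : ℕ, ∃ c : Fin (N + 1) → K, ∑ i, c i • v i = p := by
  have key : ∀ p ∈ Submodule.span K (range v),
      ∃ N : ℕ, p ∈ Submodule.span K (range fun i : Fin (N + 1) => v i) := by
    intro p hp
    refine Submodule.span_induction ?_ ?_ ?_ ?_ hp
    · rintro _ ⟨k, rfl⟩
      exact ⟨k, Submodule.subset_span ⟨Fin.last k, rfl⟩⟩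
    · exact ⟨0, Submodule.zero_mem _⟩
    · rintro x y _ _ ⟨N₁, hx⟩ ⟨N₂, hy⟩
      refine ⟨max N₁ N₂, Submodule.add_mem _ ?_ ?_⟩
      · refine Submodule.span_mono ?_ hx
        rintro _ ⟨i, rfl⟩
        exact ⟨⟨i, lt_of_lt_of_le i.2 (by omega)⟩, rfl⟩
      · refine Submodule.span_mono ?_ hy
        rintro _ ⟨i, rfl⟩
        exact ⟨⟨i, lt_of_lt_of_le i.2 (by omega)⟩, rfl⟩
    · rintro t x _ ⟨N, hx⟩
      exact ⟨N, Submodule.smul_mem _ t hx⟩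
  obtain ⟨N, hN⟩ := key p hp
  obtain ⟨c, hc⟩ := (Submodule.mem_span_range_iff_exists_fun K).mp hN
  exact ⟨N, c, hc⟩

/-- **The kernel of the lowering operator on the span is the bottom line** `K ∙ v 0`. -/
theorem mem_span_singleton_of_lower_eq_zero {p : V} (hp : p ∈ Submodule.span K (range v))
    (hD : D p = 0) : p ∈ K ∙ v 0 := by
  obtain ⟨N, c, rfl⟩ := exists_fin_sum_of_mem_span hp
  rw [h.eq_smul_of_lower_eq_zero N c hD]
  exact Submodule.mem_span_singleton.mpr ⟨c 0, rfl⟩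

/-- **Descent**: a `D`-stable subspace of `span (range v)` containing a non-zero vector contains the
bottom vector `v 0`. -/
theorem bottom_mem {M : Submodule K V} (hD : ∀ p ∈ M, D p ∈ M) {p : V} (hpM : p ∈ M)
    (hp0 : p ≠ 0) (hp : p ∈ Submodule.span K (range v)) : v 0 ∈ M := by
  obtain ⟨N, c, rfl⟩ := exists_fin_sum_of_mem_span hp
  clear hp
  induction N with
  | zero =>
    rw [Fin.sum_univ_one] at hpM hp0
    have hc : c 0 ≠ 0 := fun hc => hp0 (by rw [hc, zero_smul])
    have : v 0 = (c 0)⁻¹ • (c 0 • v 0) := by rw [smul_smul, inv_mul_cancel₀ hc, one_smul]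
    rw [this]
    exact Submodule.smul_mem _ _ hpM
  | succ N ih =>
    by_cases hq : D (∑ i, c i • v i) = 0
    · -- the combination is `c 0 • v 0` and is non-zero
      have hc : c 0 ≠ 0 := by
        intro hc0
        apply hp0
        rw [h.eq_smul_of_lower_eq_zero _ c hq, hc0, zero_smul]
      have hv : c 0 • v 0 ∈ M := by rw [← h.eq_smul_of_lower_eq_zero _ c hq]; exact hpM
      have : v 0 = (c 0)⁻¹ • (c 0 • v 0) := by rw [smul_smul, inv_mul_cancel₀ hc, one_smul]
      rw [this]
      exact Submodule.smul_mem _ _ hv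
    · -- lower once and use the induction hypothesis
      have hmem : D (∑ i, c i • v i) ∈ M := hD _ hpM
      rw [h.lower_sum] at hmem hq
      exact ih _ hmem hq

/-- Raising from the bottom: an `R`-stable subspace containing `v 0` contains every `v k`. -/
theorem mem_of_bottom_mem {M : Submodule K V} (hR : ∀ p ∈ M, R p ∈ M) (h0 : v 0 ∈ M) (k : ℕ) :
    v k ∈ M := by
  induction k with
  | zero => exact h0
  | succ k ih =>
    have : v (k + 1) = (r k)⁻¹ • R (v k) := by
      rw [h.raise, smul_smul, inv_mul_cancel₀ (h.r_ne k), one_smul]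
    rw [this]
    exact Submodule.smul_mem _ _ (hR _ ih)

/-- **Irreducibility of the ladder**: a non-zero subspace of `span (range v)` stable under the
raising and the lowering operators is the whole span. -/
theorem eq_span_of_stable {M : Submodule K V} (hM : M ≤ Submodule.span K (range v)) (hne : M ≠ ⊥)
    (hD : ∀ p ∈ M, D p ∈ M) (hR : ∀ p ∈ M, R p ∈ M) : M = Submodule.span K (range v) := by
  refine le_antisymm hM (Submodule.span_le.mpr ?_)
  obtain ⟨p, hpM, hp0⟩ := Submodule.exists_mem_ne_zero_of_ne_bot hne
  have h0 : v 0 ∈ M := h.bottom_mem hD hpM hp0 (hM hpM)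
  rintro _ ⟨k, rfl⟩
  exact h.mem_of_bottom_mem hR h0 k

end IsLadder
end Abstract

section QLadder -- 2. the `Q`-ladder of (N4.3.P2-bis)
variable (K : Type*) [Field K]

/-- The `U(3)`-invariant quadratic `Q = Σ_{i ≤ 3} w_{i,1} w_{i,2}` of (N4.3.P2-bis), in the
polynomial ring `K[w_{i,j}]`, `i : Fin 3`, `j : Fin 2` (`j = 0` ↔ `w_{i,1}`, `j = 1` ↔ `w_{i,2}`). -/
noncomputable def Q : MvPolynomial (Fin 3 × Fin 2) K := ∑ i : Fin 3, X (i, 0) * X (i, 1)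

/-- The lowering operator `D = Σ_{i ≤ 3} ∂²/∂w_{i,1}∂w_{i,2}`. -/
noncomputable def lowering : MvPolynomial (Fin 3 × Fin 2) K →ₗ[K] MvPolynomial (Fin 3 × Fin 2) K :=
  ∑ i : Fin 3, (pderiv (i, 0)).toLinearMap ∘ₗ (pderiv (i, 1)).toLinearMap

/-- The raising operator: multiplication by `Q`. -/
noncomputable def raising : MvPolynomial (Fin 3 × Fin 2) K →ₗ[K] MvPolynomial (Fin 3 × Fin 2) K :=
  LinearMap.mulLeft K (Q K)

/-- `D p = Σ_i ∂_{w_{i,1}} ∂_{w_{i,2}} p`. -/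
theorem lowering_apply (p : MvPolynomial (Fin 3 × Fin 2) K) :
    lowering K p = ∑ i : Fin 3, pderiv (i, 0) (pderiv (i, 1) p) := by
  simp only [lowering, LinearMap.sum_apply, LinearMap.comp_apply, Derivation.coeFn_coe]

/-- `raising p = Q * p`. -/
theorem raising_apply (p : MvPolynomial (Fin 3 × Fin 2) K) : raising K p = Q K * p := rfl

/-- `∂Q/∂w_{i,2} = w_{i,1}`. -/
theorem pderiv_one_Q (i : Fin 3) : pderiv (i, 1) (Q K) = X (i, 0) := by
  fin_cases i <;> simp [Q, Fin.sum_univ_three, pderiv_X]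

/-- `∂Q/∂w_{i,1} = w_{i,2}`. -/
theorem pderiv_zero_Q (i : Fin 3) : pderiv (i, 0) (Q K) = X (i, 1) := by
  fin_cases i <;> simp [Q, Fin.sum_univ_three, pderiv_X]

/-- `n · x^(n-1) · x = n · x^n` for every `n` (truncated subtraction; the case `n = 0` is `0 = 0`). -/
theorem natCast_mul_pow_pred_mul {A : Type*} [CommSemiring A] (x : A) (n : ℕ) :
    (n : A) * x ^ (n - 1) * x = (n : A) * x ^ n := by
  cases n with
  | zero => simp
  | succ n => rw [Nat.add_sub_cancel, mul_assoc, ← pow_succ]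

/-- **The printed identity `D(Q^k) = k(k+2) Q^{k-1}`** (N4.3.P2-bis). -/
theorem lowering_Q_pow (k : ℕ) :
    lowering K (Q K ^ k) = ((k * (k + 2) : ℕ) : K) • Q K ^ (k - 1) := by
  cases k with
  | zero => simp [lowering_apply]
  | succ n =>
    rw [lowering_apply]
    have h1 : ∀ i : Fin 3, pderiv (i, 1) (Q K ^ (n + 1)) = ((n + 1 : ℕ) : MvPolynomial _ K) * Q K ^ n * X (i, 0) := by
      intro i
      rw [pderiv_pow, Nat.add_sub_cancel, pderiv_one_Q]
    have h2 : ∀ i : Fin 3, pderiv (i, 0) (((n + 1 : ℕ) : MvPolynomial _ K) * Q K ^ n * X (i, 0)) =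
        ((n + 1 : ℕ) : MvPolynomial _ K) * ((n : MvPolynomial _ K) * Q K ^ (n - 1) * X (i, 1) * X (i, 0)
          + Q K ^ n) := by
      intro i
      rw [pderiv_mul, pderiv_mul, Derivation.map_natCast, pderiv_pow, pderiv_zero_Q, pderiv_X_self]
      ring
    simp only [h1, h2]
    rw [← Finset.mul_sum, smul_eq_C_mul, map_natCast]
    have h3 : ∑ i : Fin 3, ((n : MvPolynomial _ K) * Q K ^ (n - 1) * X (i, 1) * X (i, 0) + Q K ^ n)
        = (n : MvPolynomial _ K) * Q K ^ (n - 1) * Q K + 3 * Q K ^ n := by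
      rw [Finset.sum_add_distrib]
      simp only [Q, Fin.sum_univ_three, Finset.sum_const, Finset.card_univ,
        Fintype.card_fin, nsmul_eq_mul]
      push_cast
      ring
    rw [h3, natCast_mul_pow_pred_mul, Nat.add_sub_cancel]
    push_cast
    ring

/-- `Q ≠ 0` (its partial derivative `∂Q/∂w_{1,2} = w_{1,1}` is not zero). -/
theorem Q_ne_zero : Q K ≠ 0 := by
  intro h
  have := pderiv_one_Q K 0
  rw [h, map_zero] at this
  exact X_ne_zero _ this.symm

/-- `Q` is homogeneous of degree `2`. -/
theorem isHomogeneous_Q : (Q K).IsHomogeneous 2 :=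
  IsHomogeneous.sum _ _ _ fun i _ => (isHomogeneous_X K (i, 0)).mul (isHomogeneous_X K (i, 1))

/-- The powers of `Q` are linearly independent (they are homogeneous of the distinct degrees `2k`). -/
theorem linearIndependent_Q_pow : LinearIndependent K (fun k : ℕ => Q K ^ k) := by
  have hind : iSupIndep (fun k : ℕ => homogeneousSubmodule (Fin 3 × Fin 2) K (2 * k)) :=
    (MvPolynomial.decomposition (σ := Fin 3 × Fin 2) (R := K)).isInternal.submodule_iSupIndep.comp
      (f := fun k : ℕ => 2 * k) (fun a b h => by simp only at h; omega)
  refine hind.linearIndependent _ (fun k => ?_) (fun k => pow_ne_zero k (Q_ne_zero K))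
  exact (isHomogeneous_Q K).pow k

variable [CharZero K]

/-- `ℂ[Q]` is a ladder for `raising = Q ·` and `lowering = D`, with `r k = 1` and
`a k = k (k + 2)`. -/
theorem isLadder_Q :
    IsLadder (fun k : ℕ => Q K ^ k) (raising K) (lowering K) (fun _ => (1 : K))
      (fun k => ((k * (k + 2) : ℕ) : K)) where
  linInd := linearIndependent_Q_pow K
  r_ne _ := one_ne_zero
  a_zero := by simp
  a_ne k hk := by
    have : k * (k + 2) ≠ 0 := by positivity
    exact_mod_cast this
  raise k := by rw [raising_apply, one_smul, pow_succ']
  lower k := lowering_Q_pow K k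

/-- **Irreducibility of `ℂ[Q]` under `Q ·` and `D`** (N4.3.P2-bis: «every non-zero submodule
contains `1 = Q⁰` and then every `Q^k`»): a non-zero subspace of `span {Q^k}` stable under
multiplication by `Q` and under `D` is all of `span {Q^k}`. -/
theorem QSpan_eq_of_stable {M : Submodule K (MvPolynomial (Fin 3 × Fin 2) K)}
    (hM : M ≤ Submodule.span K (range fun k : ℕ => Q K ^ k)) (hne : M ≠ ⊥)
    (hD : ∀ p ∈ M, lowering K p ∈ M) (hQ : ∀ p ∈ M, Q K * p ∈ M) :
    M = Submodule.span K (range fun k : ℕ => Q K ^ k) :=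
  (isLadder_Q K).eq_span_of_stable hM hne hD hQ

/-- **The lowest vector**: on `span {Q^k}` the kernel of `D` is the line `K ∙ 1` (the lowest
`K_W`-type `ℂ · φ`, `φ = 1`, of (N4.3.P2-bis)). -/
theorem QSpan_ker_lowering {p : MvPolynomial (Fin 3 × Fin 2) K}
    (hp : p ∈ Submodule.span K (range fun k : ℕ => Q K ^ k)) (hD : lowering K p = 0) :
    p ∈ K ∙ (1 : MvPolynomial (Fin 3 × Fin 2) K) := by
  have := (isLadder_Q K).mem_span_singleton_of_lower_eq_zero hp hD
  simpa using this

omit [CharZero K] in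
/-- The constant `1 = Q⁰` does lie in the kernel of `D` (so the line of `QSpan_ker_lowering` is
exactly `K ∙ 1`). -/
theorem lowering_one : lowering K (1 : MvPolynomial (Fin 3 × Fin 2) K) = 0 := by
  simpa using lowering_Q_pow K 0

end QLadder
section TwoVariable -- 3. the two-variable ladder of (N4.3.P2-ter)
variable (K : Type*) [Field K]

/-- The monomial `w₁^{a+k} w₂^{b+k}` (`X 0 = w₁`, `X 1 = w₂`). -/
noncomputable def mono (a b k : ℕ) : MvPolynomial (Fin 2) K := X 0 ^ (a + k) * X 1 ^ (b + k)

/-- The lowering operator `∂²/∂w₁∂w₂`. -/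
noncomputable def lowering₂ : MvPolynomial (Fin 2) K →ₗ[K] MvPolynomial (Fin 2) K :=
  (pderiv 0).toLinearMap ∘ₗ (pderiv 1).toLinearMap

/-- The raising operator: multiplication by `w₁ w₂`. -/
noncomputable def raising₂ : MvPolynomial (Fin 2) K →ₗ[K] MvPolynomial (Fin 2) K :=
  LinearMap.mulLeft K (X 0 * X 1)

/-- `lowering₂ p = ∂_{w₁} ∂_{w₂} p`. -/
theorem lowering₂_apply (p : MvPolynomial (Fin 2) K) :
    lowering₂ K p = pderiv 0 (pderiv 1 p) := rfl

/-- `raising₂ p = w₁ w₂ * p`. -/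
theorem raising₂_apply (p : MvPolynomial (Fin 2) K) : raising₂ K p = X 0 * X 1 * p := rfl

/-- `∂²/∂w₁∂w₂ (w₁^α w₂^β) = α β · w₁^{α-1} w₂^{β-1}` (N4.3.P2-ter). -/
theorem lowering₂_X_pow_mul_X_pow (α β : ℕ) :
    lowering₂ K (X 0 ^ α * X 1 ^ β) = ((α * β : ℕ) : K) • (X 0 ^ (α - 1) * X 1 ^ (β - 1)) := by
  have h01 : (0 : Fin 2) ≠ 1 := by decide
  have h10 : (1 : Fin 2) ≠ 0 := by decide
  simp only [lowering₂_apply, pderiv_mul, pderiv_pow, pderiv_X_self, pderiv_X_of_ne h01,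
    pderiv_X_of_ne h10, Derivation.map_natCast, mul_zero, zero_mul, add_zero, zero_add, mul_one]
  rw [smul_eq_C_mul, map_natCast]
  push_cast
  ring

/-- The ladder identity `D (mono k) = (a+k)(b+k) • mono (k-1)`, valid for every `k` once
`a b = 0` (the bottom vector `w₁^a w₂^b` is killed exactly because one exponent is `0`). -/
theorem lowering₂_mono (a b : ℕ) (hab : a * b = 0) (k : ℕ) :
    lowering₂ K (mono K a b k) = (((a + k) * (b + k) : ℕ) : K) • mono K a b (k - 1) := by
  cases k with
  | zero =>
    simp only [mono, add_zero, zero_tsub, hab, Nat.cast_zero, zero_smul]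
    rw [lowering₂_X_pow_mul_X_pow, hab]
    simp
  | succ k =>
    simp only [mono, Nat.add_sub_cancel]
    rw [lowering₂_X_pow_mul_X_pow]
    congr 2

/-- The monomials `w₁^{a+k} w₂^{b+k}` are linearly independent (distinct monomials). -/
theorem linearIndependent_mono (a b : ℕ) : LinearIndependent K (fun k : ℕ => mono K a b k) := by
  have hmono : ∀ k, mono K a b k = (basisMonomials (Fin 2) K)
      (Finsupp.single 0 (a + k) + Finsupp.single 1 (b + k)) := by
    intro k
    rw [coe_basisMonomials, mono, X_pow_eq_monomial, X_pow_eq_monomial, monomial_mul, one_mul]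
  simp_rw [hmono]
  refine (basisMonomials (Fin 2) K).linearIndependent.comp _ ?_
  intro k k' hkk'
  have := DFunLike.congr_fun hkk' 0
  simp at this
  exact this

variable [CharZero K]

/-- The weight-`c` ladder of (N4.3.P2-ter) is a ladder for `raising₂` and `lowering₂`, with
`r k = 1` and `a k = (a+k)(b+k)`, provided `a b = 0`. -/
theorem isLadder_mono (a b : ℕ) (hab : a * b = 0) :
    IsLadder (fun k : ℕ => mono K a b k) (raising₂ K) (lowering₂ K) (fun _ => (1 : K))
      (fun k => (((a + k) * (b + k) : ℕ) : K)) where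
  linInd := linearIndependent_mono K a b
  r_ne _ := one_ne_zero
  a_zero := by simp [hab]
  a_ne k hk := by
    have : (a + k) * (b + k) ≠ 0 := by positivity
    exact_mod_cast this
  raise k := by
    rw [raising₂_apply, one_smul, mono, mono, ← add_assoc, ← add_assoc, pow_succ, pow_succ]
    ring
  lower k := lowering₂_mono K a b hab k

/-- **Irreducibility of the weight-`c` ladder** (N4.3.P2-ter): a non-zero subspace of
`span {w₁^{a+k} w₂^{b+k}}` (with `a b = 0`) stable under `w₁w₂ ·` and `∂²/∂w₁∂w₂` is the whole
span. -/
theorem monoSpan_eq_of_stable (a b : ℕ) (hab : a * b = 0) {M : Submodule K (MvPolynomial (Fin 2) K)}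
    (hM : M ≤ Submodule.span K (range fun k : ℕ => mono K a b k)) (hne : M ≠ ⊥)
    (hD : ∀ p ∈ M, lowering₂ K p ∈ M) (hR : ∀ p ∈ M, X 0 * X 1 * p ∈ M) :
    M = Submodule.span K (range fun k : ℕ => mono K a b k) :=
  (isLadder_mono K a b hab).eq_span_of_stable hM hne hD hR

/-- **The lowest vector** of the weight-`c` ladder: on the span the kernel of `∂²/∂w₁∂w₂` is the line
`K ∙ w₁^a w₂^b`. -/
theorem monoSpan_ker_lowering (a b : ℕ) (hab : a * b = 0) {p : MvPolynomial (Fin 2) K}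
    (hp : p ∈ Submodule.span K (range fun k : ℕ => mono K a b k)) (hD : lowering₂ K p = 0) :
    p ∈ K ∙ (X 0 ^ a * X 1 ^ b : MvPolynomial (Fin 2) K) := by
  have := (isLadder_mono K a b hab).mem_span_singleton_of_lower_eq_zero hp hD
  simpa [mono] using this

omit [CharZero K] in
/-- The exponents of (N4.3.P2-ter): for a weight `c : ℤ`, `a = max(0, -c)` and `b = max(0, c)`
satisfy `a b = 0`. -/
theorem toNat_neg_mul_toNat (c : ℤ) : (-c).toNat * c.toNat = 0 := by
  by_cases hc : 0 ≤ c
  · rw [Int.toNat_of_nonpos (show -c ≤ 0 by omega), zero_mul]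
  · rw [Int.toNat_of_nonpos (show c ≤ 0 by omega), mul_zero]

end TwoVariable
end Summit.Ventures.HodgeRepro2.FockLadder
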